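import Literature.Computability.Cryptography.LWEFirstIsErrorless
import Literature.Computability.Cryptography.LWEProofs
import HarnessLib

/-!
# The reduction of BLPRS 2013, Lemma 4.3 (first-is-errorless LWE): output laws and advantage accounting

Topic `Computability/Cryptography` (LWE), grouping namespace `LWE`; continuation of
`LWEFirstIsErrorless.lean` (Def. 4.2, the sample map of Lemma 4.3 and its exact single-sample and
block laws), towards the named fact
`Literature.Computability.Cryptography.blprs_gapSVP_sqrt_dim_to_lwe_classical` (**pqc.S21**). Here the
whole printed reduction of Lemma 4.3 is assembled and its advantage loss is computed:

* `felTransform Good cpl m` — **the reduction as a Markov kernel on sample tuples**, for an arbitrary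
  decidable admissibility predicate `Good` on first vectors `a' ∈ R^{k+1}` (printed: "the gcd of the
  coordinates of `a'` is coprime to `q`") and completion procedure `cpl` (printed: extended GCD) which on
  good `a'` returns a matrix invertible over `R` with leftmost column `a'` (hypothesis `hcpl`); outside
  `Good` it aborts (outputs the fixed tuple `0`). `felReduction Good cpl m D` — the `LWE_{k,m}`
  distinguisher `S ↦ D(felTransform S)`;
* `lweSamplesUniformSecret_bind_felTransform` — **LWE world**: on `A_{s,χ}^m` with `s` uniform the
  output is, conditionally on a good `a'`, EXACTLY scenario (ii) of Def. 4.2 with first vector `a'`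
  (`felCond`), since `(s₀, s) ↦ s' = (U⁻¹)ᵀ(s₀|s)` is a bijection ("`U`, being invertible modulo `q`,
  induces a bijection on `ℤ_qⁿ`, and so `s'` is uniform");
* `uniformSamples_bind_felTransform` — **uniform world**: conditionally on a good `a'`, exactly
  scenario (i) with first vector `a'` (`felUniformCond`);
* `abs_toReal_acceptProb_sub_le_of_ite` — the elementary accounting of an abort depending only on the
  reduction's own uniform choice: for kernels `F, G` and the aborting kernels
  `F' = (Good ? F : δ_z)`, `G' = (Good ? G : δ_z)`,
  `|Pr[D(U ∘ F)] - Pr[D(U ∘ G)]| ≤ |Pr[D(U ∘ F')] - Pr[D(U ∘ G')]| + Pr_U[¬ Good]` (`badFraction`);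
* **`felAdvantage_le`** — Lemma 4.3: `Adv_fel(D) ≤ Adv_{LWE_{k,m}}(felReduction D) + Pr_{a'}[¬ Good a']`.
  With `Pr[¬ Good] ≤ ∑_{p | q} p^{-(k+1)}` (`LWEFirstIsErrorlessZMod.lean`) this is the printed
  "reduces the advantage by at most `∑_{p | q prime} p^{-n}`", `n = k + 1`.

## References

* Z. Brakerski, A. Langlois, C. Peikert, O. Regev, D. Stehlé, *Classical hardness of learning with
  errors*, STOC 2013; arXiv:1306.0281, §4.1, Def. 4.2, Lemma 4.3 and its proof.
-/

noncomputable section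

open scoped ENNReal
open Matrix

namespace Literature.Computability.Cryptography

namespace LWE

open Literature.Probability.Distributions

variable {R : Type} [CommRing R]

/-! ### The whole reduction as a kernel, and its output law in the two worlds -/

section Transform

variable [Fintype R] {k : ℕ}

/-- **The reduction of Lemma 4.3 as a Markov kernel on sample tuples.** Parameters: a decidable
admissibility predicate `Good` on first vectors `a' ∈ R^{k+1}` (the printed one: "the gcd of the
coordinates of `a'` is coprime to `q`") and a completion procedure `cpl` (the printed one: extended
GCD) returning, on good `a'`, a matrix invertible over `R` with leftmost column `a'`. On input `m`
samples: choose `a'` uniformly; if it is not good, abort (output the fixed tuple `0`); otherwise pick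
`s₀` uniformly, output the first sample `(a', s₀)` and the `m` transformed samples.
[cite: BrakerskiEtAl2013, Lemma 4.3 (proof)] -/
def felTransform (Good : (Fin (k + 1) → R) → Prop) [DecidablePred Good]
    (cpl : (Fin (k + 1) → R) → Matrix (Fin (k + 1)) (Fin (k + 1)) R) (m : ℕ)
    (S : Fin m → (Fin k → R) × R) :
    PMF (((Fin (k + 1) → R) × R) × (Fin m → (Fin (k + 1) → R) × R)) :=
  (PMF.uniformOfFintype (Fin (k + 1) → R)).bind fun a' =>
    if Good a' then
      (PMF.uniformOfFintype R).bind fun s₀ => (felCoinsMap (cpl a') s₀ m S).map fun S' => ((a', s₀), S')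
    else PMF.pure 0

/-- The `LWE_{k,m}` distinguisher obtained from a first-is-errorless distinguisher `D` through the
reduction (`𝒜^ℬ` of the paper: transform, then apply the oracle). [cite: BrakerskiEtAl2013, Lemma 4.3] -/
def felReduction (Good : (Fin (k + 1) → R) → Prop) [DecidablePred Good]
    (cpl : (Fin (k + 1) → R) → Matrix (Fin (k + 1)) (Fin (k + 1)) R) (m : ℕ)
    (D : ((Fin (k + 1) → R) × R) × (Fin m → (Fin (k + 1) → R) × R) → PMF Bool) :
    Distinguisher (Fin k) R m :=
  fun S => (felTransform Good cpl m S).bind D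

/-- Scenario (ii) conditioned on the first vector `a'`: `s'` uniform, first sample `(a', ⟨a', s'⟩)`,
then `A_{s',χ}^m`. [cite: BrakerskiEtAl2013, Def. 4.2] -/
def felCond (χ : PMF R) (m : ℕ) (a' : Fin (k + 1) → R) :
    PMF (((Fin (k + 1) → R) × R) × (Fin m → (Fin (k + 1) → R) × R)) :=
  (PMF.uniformOfFintype (Fin (k + 1) → R)).bind fun s' =>
    (lweSamples χ s' m).map fun S' => ((a', a' ⬝ᵥ s'), S')

variable (R) in
/-- Scenario (i) conditioned on the first vector `a'`: everything else uniform. [cite: BrakerskiEtAl2013, Def. 4.2] -/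
def felUniformCond (m : ℕ) (a' : Fin (k + 1) → R) :
    PMF (((Fin (k + 1) → R) × R) × (Fin m → (Fin (k + 1) → R) × R)) :=
  (PMF.uniformOfFintype R).bind fun b => (uniformSamples (Fin (k + 1)) R m).map fun S' => ((a', b), S')

/-- Scenario (ii) is the uniform mixture over `a'` of its conditional versions. [cite: BrakerskiEtAl2013, Def. 4.2] -/
theorem felSamplesUniformSecret_eq_bind (χ : PMF R) (m : ℕ) :
    felSamplesUniformSecret χ m = (PMF.uniformOfFintype (Fin (k + 1) → R)).bind (felCond χ m) := by
  rw [felSamplesUniformSecret]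
  simp_rw [felSamples, prodLaw, PMF.bind_map]
  rw [PMF.bind_comm]
  rfl

/-- Scenario (i) is the uniform mixture over `a'` of its conditional versions. [cite: BrakerskiEtAl2013, Def. 4.2] -/
theorem felUniform_eq_bind (m : ℕ) :
    felUniform R (k + 1) m = (PMF.uniformOfFintype (Fin (k + 1) → R)).bind (felUniformCond R m) := by
  rw [felUniform, ← prodLaw_uniformOfFintype, ← prodLaw_uniformOfFintype, prodLaw, prodLaw, PMF.bind_bind]
  refine congrArg _ (funext fun a' => ?_)
  rw [PMF.bind_map, felUniformCond, uniformSamples]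
  refine congrArg _ (funext fun b => ?_)
  rfl

/-- A bind whose continuation does not depend on the sample through the test collapses on the
aborting branch. [folklore] -/
theorem bind_ite_pure {α β : Type} (P : PMF α) (c : Prop) [Decidable c] (f : α → PMF β) (z : β) :
    (P.bind fun x => if c then f x else PMF.pure z) = if c then P.bind f else PMF.pure z := by
  split_ifs
  · rfl
  · exact PMF.bind_const P _

/-- On a good first vector, the reduction fed with `A_{s,χ}^m` and averaged over its own `s₀`:
replace the transformed block by `A_{s',χ}^m` and the first sample `(a', s₀)` by `(a', ⟨a', s'⟩)`.
[cite: BrakerskiEtAl2013, Lemma 4.3 (proof)] -/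
theorem lweSamples_bind_felBranch (χ : PMF R) {U : Matrix (Fin (k + 1)) (Fin (k + 1)) R}
    (hU : IsUnit U.det) {a' : Fin (k + 1) → R} (hcol : (fun i => U i 0) = a') (m : ℕ) (s : Fin k → R) :
    ((lweSamples χ s m).bind fun S => (PMF.uniformOfFintype R).bind fun s₀ =>
        (felCoinsMap U s₀ m S).map fun S' => ((a', s₀), S')) =
      (PMF.uniformOfFintype R).bind fun s₀ =>
        (lweSamples χ (felSecret U s₀ s) m).map fun S' => ((a', a' ⬝ᵥ felSecret U s₀ s), S') := by
  rw [PMF.bind_comm]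
  refine congrArg _ (funext fun s₀ => ?_)
  rw [← PMF.map_bind, lweSamples_bind_felCoinsMap χ hU, col_dotProduct_felSecret hU hcol]

/-- On a good first vector, averaging moreover over the INPUT secret `s`: since
`(s₀, s) ↦ s' = (U⁻¹)ᵀ(s₀|s)` is a bijection, the output is scenario (ii) conditioned on `a'`
("`U`, being invertible modulo `q`, induces a bijection on `ℤ_qⁿ`, and so `s'` is uniform").
[cite: BrakerskiEtAl2013, Lemma 4.3 (proof)] -/
theorem uniform_bind_lweSamples_bind_felBranch (χ : PMF R) {U : Matrix (Fin (k + 1)) (Fin (k + 1)) R}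
    (hU : IsUnit U.det) {a' : Fin (k + 1) → R} (hcol : (fun i => U i 0) = a') (m : ℕ) :
    ((PMF.uniformOfFintype (Fin k → R)).bind fun s => (lweSamples χ s m).bind fun S =>
        (PMF.uniformOfFintype R).bind fun s₀ => (felCoinsMap U s₀ m S).map fun S' => ((a', s₀), S')) =
      felCond χ m a' := by
  simp_rw [lweSamples_bind_felBranch χ hU hcol]
  rw [PMF.bind_comm]
  -- `(s₀, s) ↦ (U⁻¹)ᵀ (s₀|s)` is a bijection `R × Rᵏ → R^{k+1}`
  have hUt : IsUnit ((U⁻¹)ᵀ).det := by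
    rw [det_transpose]
    exact (isUnit_nonsing_inv_det_iff).2 hU
  have hσ : Function.Bijective fun p : R × (Fin k → R) => felSecret U p.1 p.2 :=
    mulVec_vecCons_bijective hUt
  calc ((PMF.uniformOfFintype R).bind fun s₀ => (PMF.uniformOfFintype (Fin k → R)).bind fun s =>
          (lweSamples χ (felSecret U s₀ s) m).map fun S' => ((a', a' ⬝ᵥ felSecret U s₀ s), S'))
      = (prodLaw (PMF.uniformOfFintype R) (PMF.uniformOfFintype (Fin k → R))).bind fun p =>
          (lweSamples χ (felSecret U p.1 p.2) m).map fun S' => ((a', a' ⬝ᵥ felSecret U p.1 p.2), S') := by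
        rw [prodLaw, PMF.bind_bind]
        refine congrArg _ (funext fun s₀ => ?_)
        rw [PMF.bind_map]
        rfl
    _ = ((PMF.uniformOfFintype (R × (Fin k → R))).map fun p => felSecret U p.1 p.2).bind fun s' =>
          (lweSamples χ s' m).map fun S' => ((a', a' ⬝ᵥ s'), S') := by
        rw [prodLaw_uniformOfFintype, PMF.bind_map]
        rfl
    _ = felCond χ m a' := by
        rw [uniformOfFintype_map_of_bijective hσ]
        rfl

/-- **Lemma 4.3, the LWE world.** Feeding the reduction with `LWE_{k,m}` samples for a uniform secret
produces, conditionally on a good first vector `a'`, EXACTLY scenario (ii) of first-is-errorless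
`LWE_{k+1,1+m}` with first vector `a'` ("the reduction outputs one sample from `A_{q,s',{0}}` and the
remaining samples from `A_{q,s',φ}` … `s'` is uniform in `{0, …, q-1}ⁿ`"); on a bad `a'` it aborts.
Hypothesis: on good `a'` the completion is invertible with leftmost column `a'`.
[cite: BrakerskiEtAl2013, Lemma 4.3 (proof)] -/
theorem lweSamplesUniformSecret_bind_felTransform (χ : PMF R) {Good : (Fin (k + 1) → R) → Prop}
    [DecidablePred Good] {cpl : (Fin (k + 1) → R) → Matrix (Fin (k + 1)) (Fin (k + 1)) R}
    (hcpl : ∀ a', Good a' → IsUnit (cpl a').det ∧ (fun i => cpl a' i 0) = a') (m : ℕ) :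
    (lweSamplesUniformSecret χ m).bind (felTransform Good cpl m) =
      (PMF.uniformOfFintype (Fin (k + 1) → R)).bind fun a' =>
        if Good a' then felCond χ m a' else PMF.pure 0 := by
  -- the reduction on the samples of a FIXED secret `s`, the choice of `a'` moved outside
  have h1 : ∀ s : Fin k → R, (lweSamples χ s m).bind (felTransform Good cpl m) =
      (PMF.uniformOfFintype (Fin (k + 1) → R)).bind fun a' =>
        if Good a' then (lweSamples χ s m).bind fun S => (PMF.uniformOfFintype R).bind fun s₀ =>
          (felCoinsMap (cpl a') s₀ m S).map fun S' => ((a', s₀), S')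
        else PMF.pure 0 := by
    intro s
    unfold felTransform
    rw [PMF.bind_comm]
    refine congrArg _ (funext fun a' => ?_)
    rw [bind_ite_pure]
  rw [lweSamplesUniformSecret, PMF.bind_bind]
  simp_rw [h1]
  rw [PMF.bind_comm]
  refine congrArg _ (funext fun a' => ?_)
  rw [bind_ite_pure]
  split_ifs with ha
  · obtain ⟨hU, hcol⟩ := hcpl a' ha
    exact uniform_bind_lweSamples_bind_felBranch χ hU hcol m
  · rfl

/-- **Lemma 4.3, the uniform world.** Feeding the reduction with uniform samples produces,
conditionally on a good first vector `a'`, exactly scenario (i) with first vector `a'` ("given uniform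
samples, the reduction outputs uniform samples, with the first sample's `b` component uniform over
`𝕋_q`"); on a bad `a'` it aborts. [cite: BrakerskiEtAl2013, Lemma 4.3 (proof)] -/
theorem uniformSamples_bind_felTransform {Good : (Fin (k + 1) → R) → Prop} [DecidablePred Good]
    {cpl : (Fin (k + 1) → R) → Matrix (Fin (k + 1)) (Fin (k + 1)) R}
    (hcpl : ∀ a', Good a' → IsUnit (cpl a').det ∧ (fun i => cpl a' i 0) = a') (m : ℕ) :
    (uniformSamples (Fin k) R m).bind (felTransform Good cpl m) =
      (PMF.uniformOfFintype (Fin (k + 1) → R)).bind fun a' =>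
        if Good a' then felUniformCond R m a' else PMF.pure 0 := by
  unfold felTransform
  rw [PMF.bind_comm]
  refine congrArg _ (funext fun a' => ?_)
  rw [bind_ite_pure]
  split_ifs with ha
  · obtain ⟨hU, -⟩ := hcpl a' ha
    rw [PMF.bind_comm, felUniformCond]
    refine congrArg _ (funext fun s₀ => ?_)
    rw [← PMF.map_bind, uniformSamples_bind_felCoinsMap hU]
  · rfl

end Transform

/-! ### Advantage accounting: an abort depending only on the reduction's own coins -/

section Accounting

variable {α β : Type} [Fintype α]

/-- The fraction of bad first choices, `Pr_{a ← U_α}[¬ Good a] = #{a | ¬ Good a} / |α|`. [folklore] -/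
def badFraction (Good : α → Prop) [DecidablePred Good] : ℝ :=
  ((Finset.univ.filter fun a => ¬ Good a).card : ℝ) / Fintype.card α

/-- `badFraction` is nonnegative. [folklore] -/
theorem badFraction_nonneg (Good : α → Prop) [DecidablePred Good] : 0 ≤ badFraction Good :=
  div_nonneg (Nat.cast_nonneg _) (Nat.cast_nonneg _)

variable [Nonempty α]

/-- Acceptance probability of `D` on a uniform mixture: `Pr[D(U_α ∘ F)] = |α|⁻¹ ∑ₐ Pr[D(F a)]`.
[folklore] -/
theorem toReal_acceptProb_uniform_bind (F : α → PMF β) (D : β → PMF Bool) :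
    (acceptProb D ((PMF.uniformOfFintype α).bind F)).toReal =
      ∑ a, (Fintype.card α : ℝ)⁻¹ * (acceptProb D (F a)).toReal := by
  unfold acceptProb
  rw [PMF.bind_bind, PMF.bind_apply, tsum_fintype,
    ENNReal.toReal_sum (fun a _ => ENNReal.mul_ne_top (PMF.apply_ne_top _ _) (PMF.apply_ne_top _ _))]
  refine Finset.sum_congr rfl fun a _ => ?_
  rw [ENNReal.toReal_mul, PMF.uniformOfFintype_apply, ENNReal.toReal_inv, ENNReal.toReal_natCast]

/-- **Abort accounting.** Let the reduction first draw `a ← U_α`; on good `a` it produces `F a` (in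
one world) resp. `G a` (in the other), on bad `a` it outputs a fixed `z` in both worlds. Then the
advantage of any `D` between the two NON-aborting mixtures exceeds its advantage between the aborting
ones by at most `Pr[¬ Good]`: the bad terms cancel in the aborting difference and are each at most
`|α|⁻¹` in the other. [cite: BrakerskiEtAl2013, Lemma 4.3 (proof: "If it is not coprime to q, we abort. The probability that this happens is at most …")] -/
theorem abs_toReal_acceptProb_sub_le_of_ite (Good : α → Prop) [DecidablePred Good] (F G : α → PMF β)
    (z : β) (D : β → PMF Bool) :
    |(acceptProb D ((PMF.uniformOfFintype α).bind F)).toReal -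
        (acceptProb D ((PMF.uniformOfFintype α).bind G)).toReal| ≤
      |(acceptProb D ((PMF.uniformOfFintype α).bind fun a => if Good a then F a else PMF.pure z)).toReal -
          (acceptProb D ((PMF.uniformOfFintype α).bind fun a => if Good a then G a else PMF.pure z)).toReal| +
        badFraction Good := by
  simp only [toReal_acceptProb_uniform_bind, ← Finset.sum_sub_distrib, ← mul_sub]
  set w : ℝ := (Fintype.card α : ℝ)⁻¹ with hw
  set x : α → ℝ := fun a => (acceptProb D (F a)).toReal with hx
  set y : α → ℝ := fun a => (acceptProb D (G a)).toReal with hy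
  have hw0 : 0 ≤ w := by positivity
  -- the aborting difference keeps only the good terms
  have hite : ∀ a, w * ((acceptProb D (if Good a then F a else PMF.pure z)).toReal -
      (acceptProb D (if Good a then G a else PMF.pure z)).toReal) =
      if Good a then w * (x a - y a) else 0 := by
    intro a
    split_ifs <;> simp [x, y]
  simp_rw [hite]
  rw [Finset.sum_ite, Finset.sum_const_zero, add_zero]
  -- split the non-aborting difference into good and bad terms
  rw [← Finset.sum_filter_add_sum_filter_not Finset.univ Good fun a => w * (x a - y a)]
  refine (abs_add_le _ _).trans (add_le_add le_rfl ?_)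
  -- each bad term is at most `w`
  refine (Finset.abs_sum_le_sum_abs _ _).trans ?_
  have hterm : ∀ a, |w * (x a - y a)| ≤ w := fun a => by
    rw [abs_mul, abs_of_nonneg hw0]
    exact mul_le_of_le_one_right hw0 (abs_toReal_acceptProb_sub_le_one D (F a) D (G a))
  refine (Finset.sum_le_sum fun a _ => hterm a).trans ?_
  rw [Finset.sum_const, nsmul_eq_mul, badFraction, hw, div_eq_mul_inv]

end Accounting

/-! ### Lemma 4.3: the advantage loss of the reduction -/

section Lemma43

variable [Fintype R] {k : ℕ}

/-- **BLPRS 2013, Lemma 4.3 (advantage form, any finite commutative ring, any abort rule).** For every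
first-is-errorless distinguisher `D` on `LWE_{k+1, 1+m}`, the `LWE_{k,m}` distinguisher
`felReduction Good cpl m D` (the printed transformation reduction followed by `D`) satisfies
`Adv_fel(D) ≤ Adv(felReduction D) + Pr_{a' ← U}[¬ Good a']`, provided the completion `cpl` returns on
every good `a'` a matrix invertible over `R` with leftmost column `a'`. (Over `ℤ_q` with the printed
abort rule, `Pr[¬ Good] ≤ ∑_{p | q prime} p^{-(k+1)}`: sibling file `LWEFirstIsErrorlessZMod.lean`.)
[cite: BrakerskiEtAl2013, Lemma 4.3] -/
theorem felAdvantage_le (χ : PMF R) {Good : (Fin (k + 1) → R) → Prop} [DecidablePred Good]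
    {cpl : (Fin (k + 1) → R) → Matrix (Fin (k + 1)) (Fin (k + 1)) R}
    (hcpl : ∀ a', Good a' → IsUnit (cpl a').det ∧ (fun i => cpl a' i 0) = a') (m : ℕ)
    (D : ((Fin (k + 1) → R) × R) × (Fin m → (Fin (k + 1) → R) × R) → PMF Bool) :
    felAdvantage χ m D ≤ distinguishingAdvantage χ m (felReduction Good cpl m D) + badFraction Good := by
  have hbind : ∀ P : PMF (Fin m → (Fin k → R) × R),
      acceptProb (felReduction Good cpl m D) P = acceptProb D (P.bind (felTransform Good cpl m)) := by
    intro P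
    unfold acceptProb felReduction
    rw [PMF.bind_bind]
  unfold felAdvantage distinguishingAdvantage
  rw [hbind, hbind, lweSamplesUniformSecret_bind_felTransform χ hcpl, uniformSamples_bind_felTransform hcpl,
    felSamplesUniformSecret_eq_bind, felUniform_eq_bind]
  exact abs_toReal_acceptProb_sub_le_of_ite Good (felCond χ m) (felUniformCond R m) 0 D

end Lemma43

end LWE

end Literature.Computability.Cryptography

end
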